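import Literature.NumberTheory.GaloisCohomology.Howard2004.DualityDatumValueMapTwoInjectiveProofs
import Literature.NumberTheory.EllipticCurves.ZpExtensionEisensteinDVRSettingH4PerfectProofs
import Literature.NumberTheory.EllipticCurves.ZpExtensionEisensteinDVRSettingH4AdjointProofs
import Literature.NumberTheory.EllipticCurves.IwasawaEisensteinTwistedReadoutReduceProofs
import Literature.NumberTheory.GaloisRepresentations.RootsOfUnityInverseLimit
import Literature.NumberTheory.GaloisRepresentations.LocalKummerTorsion
import HarnessLib

/-!
# The value tower `H²(K_v, A_{m,•}(1))` of Howard's induced local pairings has torsion-free limit, upward: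
# `H²(K_v, ι(1))` is INJECTIVE for the value maps `ι = «×p^{b−a}» : A_{m,a} → A_{m,b}` (proofs)

`Proofs` file (theorems only; no definition, no named fact, no instance, no `sorry`).  Instance of
`Howard2004/DualityDatumValueMapTwoInjectiveProofs` (§2, character lifting) for Howard's level rings
`A_{m,k} = Λ/(T^m + p, p^k)` of the Eisenstein specialisation.

For a value map `ι : A_{m,a} → A_{m,b}` with `ι ∘ reduce = p^{b−a} ·` (x9-p1-w2's
`EisensteinCoeff.exists_addMonoidHom_apply_reduce_eq_pow_smul`) and ANY two H.4 data `D₁`, `D₂` over `A_{m,a}`, `A_{m,b}`, the map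
`H²(K_v, ι(1)) : H²(K_v, A_{m,a}(1)) → H²(K_v, A_{m,b}(1))` is injective at every place `v`
(`EisensteinCoeff.cohomologyMap_two_injective_of_apply_reduce`) — the hypothesis `hιinj` of
`Tower.exists_sub_pow_smul_forall_pairing_eq_zero` ((EXACT-REP) of Howard's H.4 for `F_𝔮` at `v ∣ p`).  The character lift: for
a COMPATIBLE system of logarithms of `μ_{p^•}` (`exists_compatible_muLog`) and the tail forms `λ_•` (compatible:
x10b-p2's `EisensteinCoeff.tailFormZMod_reduce`), `(μ_{p^a} ⊆ μ_{p^b}) ∘ exp_a ∘ λ_a ∘ (r ·) = exp_b ∘ λ_b ∘ (r̃ ·) ∘ ι` for any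
lift `r̃` of `r` (§1 `muInclusion_exp_castHom_eq_pow_smul_exp` — «`ζ_a^{z mod p^a} = ζ_b^{p^{b−a} z}`» for `ζ_a = ζ_b^{p^{b−a}}`).

Cell `pub/bsd-print-x9` (STUB A `hfin4` at `v ∣ p`, (EXACT-REP-INST) input).  BSD is not proved by any of this.
References: [Howard2004HeegnerKolyvagin] §1.3 H.4, §1.6, §2.1–2.2 (arXiv:1202.6340 p. 7, p. 11); [SerreGaloisCohomology1997] II §1.2;
[NeukirchSchmidtWingberg2008] (7.3.6); [Washington1997] §13.2.
-/

set_option autoImplicit false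

noncomputable section

open CategoryTheory Function NumberField IsDedekindDomain Field
open scoped ContRepresentation NumberField

namespace Literature.NumberTheory.GaloisRepresentations

open DiscreteGaloisModule

/-! ## §1 Compatible logarithms: `d`-step compatibility and `(μ_{p^a} ⊆ μ_{p^{a+d}}) ∘ exp_a ∘ cast = p^d • exp_{a+d}` -/

variable {K : Type} [Field K] {p : ℕ} [hp : Fact p.Prime]

/-- **`d`-step compatibility of a compatible system of logarithms**: if `log_k (ζ^p-th…)` — precisely, if
`muVal w = muVal v ^ p ⇒ log_k w = (log_{k+1} v mod p^k)` at every level — then `muVal w = muVal v ^ {p^d} ⇒ log_a w =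
(log_{a+d} v mod p^a)`. [cite: NeukirchSchmidtWingberg2008, (7.3.6)] [cite: SerreGaloisCohomology1997, Ch. II §1.2] -/
theorem muLog_apply_eq_castHom_of_muVal_eq_pow (log : (k : ℕ) → MuCarrier K (p ^ k) →+ ZMod (p ^ k))
    (hcompat : ∀ (k : ℕ) (v : MuCarrier K (p ^ (k + 1))) (w : MuCarrier K (p ^ k)),
      muVal K (p ^ k) w = muVal K (p ^ (k + 1)) v ^ p →
        log k w = ZMod.castHom (pow_dvd_pow p k.le_succ) (ZMod (p ^ k)) (log (k + 1) v))
    (a : ℕ) : ∀ (d : ℕ) (v : MuCarrier K (p ^ (a + d))) (w : MuCarrier K (p ^ a)),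
      muVal K (p ^ a) w = muVal K (p ^ (a + d)) v ^ (p ^ d) →
        log a w = ZMod.castHom (pow_dvd_pow p (Nat.le_add_right a d)) (ZMod (p ^ a)) (log (a + d) v)
  | 0, v, w, h => by
    rw [pow_zero, pow_one] at h
    have hvw : w = v := muVal_injective K _ h
    subst hvw
    exact (DFunLike.congr_fun (Subsingleton.elim (RingHom.id (ZMod (p ^ a)))
      (ZMod.castHom (pow_dvd_pow p (Nat.le_add_right a 0)) (ZMod (p ^ a)))) (log a w))
  | d + 1, v, w, h => by
    -- the intermediate root of unity `u = v^p ∈ μ_{p^{a+d}}`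
    let u : MuCarrier K (p ^ (a + d)) := muPowMap K (pow_dvd_pow p (Nat.le_succ (a + d))) v
    have hdiv : p ^ (a + d + 1) / p ^ (a + d) = p := by
      rw [pow_succ, Nat.mul_div_cancel_left _ (pow_pos hp.out.pos _)]
    have hu : muVal K (p ^ (a + d)) u = muVal K (p ^ (a + d + 1)) v ^ p := by
      change muVal K (p ^ (a + d + 1)) v ^ (p ^ (a + d + 1) / p ^ (a + d)) = _
      rw [hdiv]
    have h1 : log (a + d) u = ZMod.castHom (pow_dvd_pow p (a + d).le_succ) (ZMod (p ^ (a + d))) (log (a + d + 1) v) :=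
      hcompat (a + d) v u hu
    have h2 : muVal K (p ^ a) w = muVal K (p ^ (a + d)) u ^ (p ^ d) := by
      rw [hu, ← pow_mul, ← pow_succ']
      exact h
    rw [muLog_apply_eq_castHom_of_muVal_eq_pow log hcompat a d u w h2, h1, ← RingHom.comp_apply]
    exact DFunLike.congr_fun (Subsingleton.elim _ _) (log (a + d + 1) v)

/-- **`(μ_{p^a} ⊆ μ_{p^{a+d}}) (exp_a (z mod p^a)) = p^d • exp_{a+d} z`** for the exponentials `exp_k = log_k⁻¹` of a compatible
system of logarithms («`ζ_a^{z̄} = ζ_{a+d}^{p^d z}` for `ζ_a = ζ_{a+d}^{p^d}`»).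
[cite: NeukirchSchmidtWingberg2008, (7.3.6)] [cite: SerreGaloisCohomology1997, Ch. II §1.2] -/
theorem muInclusion_exp_castHom_eq_pow_smul_exp (log : (k : ℕ) → MuCarrier K (p ^ k) →+ ZMod (p ^ k))
    (hbij : ∀ k, Bijective (log k))
    (hcompat : ∀ (k : ℕ) (v : MuCarrier K (p ^ (k + 1))) (w : MuCarrier K (p ^ k)),
      muVal K (p ^ k) w = muVal K (p ^ (k + 1)) v ^ p →
        log k w = ZMod.castHom (pow_dvd_pow p k.le_succ) (ZMod (p ^ k)) (log (k + 1) v))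
    (a d : ℕ) (z : ZMod (p ^ (a + d))) :
    muInclusion K (pow_dvd_pow p (Nat.le_add_right a d))
        ((AddEquiv.ofBijective (log a) (hbij a)).symm
          (ZMod.castHom (pow_dvd_pow p (Nat.le_add_right a d)) (ZMod (p ^ a)) z)) =
      p ^ d • (AddEquiv.ofBijective (log (a + d)) (hbij (a + d))).symm z := by
  set La := AddEquiv.ofBijective (log a) (hbij a)
  set Lb := AddEquiv.ofBijective (log (a + d)) (hbij (a + d))
  -- `w := (exp_b z)^{p^d}` read in `μ_{p^a}` has `log_a w = z mod p^a`, hence is `exp_a (z mod p^a)`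
  let w : MuCarrier K (p ^ a) := muPowMap K (pow_dvd_pow p (Nat.le_add_right a d)) (Lb.symm z)
  have hw : muVal K (p ^ a) w = muVal K (p ^ (a + d)) (Lb.symm z) ^ (p ^ d) := by
    rw [muVal_muPowMap, Nat.pow_div (Nat.le_add_right a d) hp.out.pos, Nat.add_sub_cancel_left]
  have hlogw : log a w = ZMod.castHom (pow_dvd_pow p (Nat.le_add_right a d)) (ZMod (p ^ a)) z := by
    rw [muLog_apply_eq_castHom_of_muVal_eq_pow log hcompat a d (Lb.symm z) w hw]
    exact congrArg _ (Lb.apply_symm_apply z)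
  rw [show La.symm (ZMod.castHom (pow_dvd_pow p (Nat.le_add_right a d)) (ZMod (p ^ a)) z) = w from
    La.symm_apply_eq.2 hlogw.symm]
  exact muVal_injective K _ (by rw [muVal_muInclusion, hw, muVal_nsmul])

end Literature.NumberTheory.GaloisRepresentations

/-! ## §2 `H²(K_v, ι(1))` is injective for the value maps of Howard's level rings `A_{m,•}` -/

namespace Literature.NumberTheory.GaloisCohomology.Howard2004.DualityDatum

open Literature.NumberTheory.GaloisRepresentations Literature.NumberTheory.GaloisRepresentations.DiscreteGaloisModule
open Literature.NumberTheory.EllipticCurves Literature.NumberTheory.EllipticCurves.IwasawaAlgebra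

variable {K : Type} [Field K] [NumberField K] {p : ℕ} [hp : Fact p.Prime] {m : ℕ} (hm : 1 ≤ m)
  {cd : ConjugationDatum K}
  {M₁ : Type} [AddCommGroup M₁] [TopologicalSpace M₁] [DiscreteTopology M₁]
  {M₂ : Type} [AddCommGroup M₂] [TopologicalSpace M₂] [DiscreteTopology M₂]
  {a b : ℕ} [Module (EisensteinCoeff p m a) M₁] [Module (EisensteinCoeff p m b) M₂]
  {ρ₁ : DiscreteGaloisModule K M₁} {ρ₂ : DiscreteGaloisModule K M₂}

include hm in
/-- **`H²(K_v, ι(1)) : H²(K_v, A_{m,a}(1)) → H²(K_v, A_{m,b}(1))` is injective** for every value map `ι` with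
`ι ∘ reduce = p^{b−a} ·` (`×p^{b−a}` along the reduction), any H.4 data `D₁`, `D₂` over `A_{m,a}`, `A_{m,b}`, at every place `v` —
the hypothesis `hιinj` of `Tower.exists_sub_pow_smul_forall_pairing_eq_zero` («the value tower has torsion-free limit», upward).
Proof: character lifting (`cohomologyMap_two_injective_of_character_lift`) with a compatible system of logarithms of `μ_{p^•}`, the
tail forms `λ_a`, `λ_b` (`tailFormZMod_reduce`), the dual family of `A_{m,a}` and lifts of it to `A_{m,b}`.
[cite: Howard2004HeegnerKolyvagin, §1.3 H.4, §1.6 and §2.1–2.2 (arXiv p. 7 L78–82, p. 11 L33–38)] [cite: SerreGaloisCohomology1997, Ch. II §1.2] -/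
theorem cohomologyMap_two_injective_of_apply_reduce (hab : a ≤ b) (D₁ : DualityDatum p cd ρ₁ (EisensteinCoeff p m a))
    (D₂ : DualityDatum p cd ρ₂ (EisensteinCoeff p m b)) (ι : EisensteinCoeff p m a →+ EisensteinCoeff p m b)
    (hι : ∀ x : EisensteinCoeff p m b, ι (EisensteinCoeff.reduce p m hab x) = p ^ (b - a) • x) (v : Place K) :
    Injective (ContinuousRep.cohomologyMap (D₁.twistOne.toLocal v) (D₂.twistOne.toLocal v) ι
      continuous_of_discreteTopology (fun _ z => D₁.twistOne_apply_of_apply_reduce D₂ hab ι (p ^ (b - a)) hι _ z) 2) := by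
  obtain ⟨d, rfl⟩ := Nat.exists_eq_add_of_le hab
  have hι' : ∀ x : EisensteinCoeff p m (a + d), ι (EisensteinCoeff.reduce p m hab x) = p ^ d • x := fun x ↦ by
    rw [hι, Nat.add_sub_cancel_left]
  have hpp := hp.out
  have hpK : (p : K) ≠ 0 := by exact_mod_cast hpp.ne_zero
  -- a compatible system of logarithms and the two exponentials
  obtain ⟨log, hlogbij, hlogχ, hcompat⟩ := exists_compatible_muLog K p hpK
  let La : MuCarrier K (p ^ a) ≃+ ZMod (p ^ a) := AddEquiv.ofBijective (log a) (hlogbij a)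
  let Lb : MuCarrier K (p ^ (a + d)) ≃+ ZMod (p ^ (a + d)) := AddEquiv.ofBijective (log (a + d)) (hlogbij (a + d))
  have hexp : ∀ (n : ℕ) (L : MuCarrier K (p ^ n) ≃+ ZMod (p ^ n)), (∀ w, L w = log n w) →
      ∀ (g : absoluteGaloisGroup K) (x : ZMod (p ^ n)),
        (L.symm : ZMod (p ^ n) →+ MuCarrier K (p ^ n)) (cyclotomicCharacterModPow K p n g * x) =
          mu K (p ^ n) g ((L.symm : ZMod (p ^ n) →+ MuCarrier K (p ^ n)) x) := fun n L hL g x ↦ by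
    apply L.injective
    change L (L.symm _) = L (mu K _ g (L.symm x))
    rw [AddEquiv.apply_symm_apply, hL, hlogχ, ← hL, AddEquiv.apply_symm_apply]
  -- the tail forms
  have hlam : ∀ n : ℕ, ∀ (z : ℤ_[p]) (r : EisensteinCoeff p m n),
      (EisensteinCoeff.tailFormZMod p hm n).toAddMonoidHom (algebraMap ℤ_[p] (EisensteinCoeff p m n) z * r) =
        PadicInt.toZModPow n z * (EisensteinCoeff.tailFormZMod p hm n).toAddMonoidHom r := fun n z r ↦ by
    rw [LinearMap.toAddMonoidHom_coe, EisensteinCoeff.algebraMap_padicInt_eq_ofZMod_toZModPow p hm n,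
      EisensteinCoeff.tailFormZMod_ofZMod_mul]
  -- the dual family of `A_{m,a}` and lifts to `A_{m,a+d}`
  have hexpb : Function.Bijective (La.symm : ZMod (p ^ a) →+ MuCarrier K (p ^ a)) := La.symm.bijective
  have hbij := EisensteinCoeff.bijective_comp_tailFormZMod_dualFamily_mul p hm a _ hexpb
  choose r' hr' using fun i : Fin m ↦ EisensteinCoeff.reduce_surjective m hab (EisensteinCoeff.dualFamily p hm a i)
  -- the inclusion `μ_{p^a} ⊆ μ_{p^{a+d}}` on the local modules
  let incl : ((mu K (p ^ a)).toLocal v).toTopRep ⟶ ((mu K (p ^ (a + d))).toLocal v).toTopRep :=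
    TopRep.ofHom ⟨⟨(muInclusion K (pow_dvd_pow p (Nat.le_add_right a d))).toIntLinearMap, continuous_of_discreteTopology⟩,
      fun σ => by
        ext x
        apply muVal_injective K (p ^ (a + d))
        change muVal K (p ^ (a + d)) (muInclusion K (pow_dvd_pow p (Nat.le_add_right a d))
            (mu K (p ^ a) (absGaloisRestrict K (Place.Completion v) σ) x)) =
          muVal K (p ^ (a + d)) (mu K (p ^ (a + d)) (absGaloisRestrict K (Place.Completion v) σ)
            (muInclusion K (pow_dvd_pow p (Nat.le_add_right a d)) x))
        rw [muVal_muInclusion, muVal_apply, muVal_apply, muVal_muInclusion]⟩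
  refine D₁.cohomologyMap_two_injective_of_character_lift D₂ _ (hlam a) _ (hexp a La fun _ ↦ rfl) _ (hlam (a + d)) _
    (hexp (a + d) Lb fun _ ↦ rfl) ι (fun g z ↦ D₁.twistOne_apply_of_apply_reduce D₂ hab ι (p ^ (a + d - a)) hι g z)
    (EisensteinCoeff.dualFamily p hm a) hbij r' v incl (fun _ ↦ rfl) fun i x ↦ ?_
  -- the character identity `incl (exp_a (λ_a (r_i x))) = exp_b (λ_b (r′_i ι x))`
  obtain ⟨y, rfl⟩ := EisensteinCoeff.reduce_surjective m hab x
  change muInclusion K (pow_dvd_pow p (Nat.le_add_right a d))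
      (La.symm (EisensteinCoeff.tailFormZMod p hm a (EisensteinCoeff.dualFamily p hm a i * EisensteinCoeff.reduce p m hab y))) =
    Lb.symm (EisensteinCoeff.tailFormZMod p hm (a + d) (r' i * ι (EisensteinCoeff.reduce p m hab y)))
  rw [← hr' i, ← map_mul, EisensteinCoeff.tailFormZMod_reduce p hm hab, hι', mul_smul_comm, map_nsmul, map_nsmul]
  exact muInclusion_exp_castHom_eq_pow_smul_exp log hlogbij hcompat a d _

end Literature.NumberTheory.GaloisCohomology.Howard2004.DualityDatum

end
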